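/-
Copyright (c) 2026 the pub-hodgecm-mathlib formalisation cell (harness21).  Prover seat hodgecm-mathlib-K2Liu-p05 (g3), 2026-09-04
(Track B «K2-LIT», crux hLiu418 = stmt-HodgeConjecture-24832, socket #42F′ `sig_K2LiuFirstTermIdentityOnGenerators`, ROAD I v3 («uniqueness road»,
RULING M-156b), organ U2c «orbit uniformity + Hasse» — DEAL «M-156c» LEAD F0P6-plan (g12) 06:03:01Z, note (c-U2c): Hasse BY NAME; FILE 2∕2).
-/
import Summits.HodgeConjecture.HodgeConjecture.Theorems.K2LiuRankOneLineGram          -- file 1∕2: fibre heads + rank-one Gram algebra (σ-explicit)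
import Summits.HodgeConjecture.HodgeConjecture.Theorems.F0LD1LineClassHasse           -- ★ Hasse step for hermitian line classes over `L ∕ L⁺`
import Literature.NumberTheory.Automorphic.QuadraticLocalBaseChange                    -- ★ `LocalRing`, `conjLocal`, `toLocalRing`, `existsUnique_eq_add_mul`
import Literature.NumberTheory.Automorphic.UnitaryGroupBorelInduction                  -- ★ `conjLocal_conjLocal_cm`
import HarnessLib

/-!
# U2c, file 2∕2 «ORBIT UNIFORMITY + HASSE»: local norm classes of rank-one coefficients (`locF`) and the ONE global `GL₂(L)`-congruence orbit

Track B ∕ K2-LIT, hLiu418 = stmt-HodgeConjecture-24832, socket #42F′ (U6 ED. 10 :767), ROAD I v3 organ U2c (SIGS-RoadI-v3 §2 row U2c: «U2c-fin» in the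
tree's `locF` currency and «U2c-glob»; the sign condition «U2c-arch» is organ Hol's and enters as the hypothesis `hpos`).  Namespace
`Summit.HodgeConjecture.HodgeConjecture.Cruxes.HLiu418.K2LiuRankOneOrbitUniformity`.  THEOREMS ONLY (no definition, no instance, no notation, no named
fact, no `sorry`); kernel lane `--supports stmt-HodgeConjecture-24832 --as helper`; Hasse's norm theorem is CITED BY NAME (LEAD note (c-U2c)): ★
`F0LD1LineClassHasse.exists_eq_mul_complexConj_of_locF_eq_of_totallyPositive` (= ★ `IsCMField.exists_eq_mul_complexConj_of_totallyPositive_of_forall_isLocalNorm`,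
[Omeara1963, 65:23]) — nothing rebuilt.

THE MATHEMATICS ([KudlaRallis1994, §3]; Landherr–Hasse for hermitian forms over a CM extension = Hasse's norm theorem for `L ∕ L⁺` [Omeara1963, §65D
Thm. 65:23], [Scharlau1985HermitianForms, Ch. 10 §1]; line classes `ε_v ∈ L⁺_v^× ∕ Nm L_v^×` [Liu2021, Def. 4.11–4.12] = ★ `locF`).
* §1 LOCAL NORM CLASSES.  On `L ⊗ L⁺_v = L⁺_v ⊕ L⁺_v δ` (★ `existsUnique_eq_add_mul`) the norm form is `z · (c ⊗ 1) z = ι_v(x² − δ² y²)`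
  (`add_mul_delta_mul_conjLocal`), so «`t = σ(z) z` in `L ⊗ L⁺_v`» is «`t ∈ Nm = {x² − δ² y²}`» (★ `quadraticNormSubgroup`,
  `mem_quadraticNormSubgroup_of_eq_mul_conjLocal`) and «`ι_v b = ι_v a · z z̄`» is «`locF b v = locF a v`» (`locF_eq_of_eq_mul_conjLocal`).  With file 1∕2
  this gives the dock-ready «U2c-fin» **`locF_eq_of_functional_ne_zero`**: in the σ-explicit model of U2a at `v` (`R = LocalRing L v`, `σ = conjLocal`,
  line `⟨a′⟩`), a NON-ZERO `ψ_β`-quasi-invariant functional for `β = ι_v b · σ(u) ⊗ u` (`u` unimodular — the class of `diag(b, 0)`) forces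
  `locF b v = locF a′ v` («`b ∕ a′ ∈ N(L_v^×)`»).
* §2 GLOBAL («U2c-glob»).  Equal line classes at every finite place + `b ∕ a′` totally positive ⇒ `b = a′ · ē e`, `e ≠ 0` (Hasse BY NAME), hence
  **`lineGram_transport_of_locF_eq_of_totallyPositive`** (`b · c(u) ⊗ u = a′ · c(e u) ⊗ (e u)`) and the head **`rankOneOrbitUniformity`**:
  `(cγ)ᵀ diag(b, 0) γ = (cγ′)ᵀ diag(a′, 0) γ′` with `γ′ = diag(e, 1) γ` — ALL rank-one hermitian `β` carrying a non-zero coefficient lie in ONE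
  `GL₂(L)`-congruence orbit, that of `diag(a′, 0)` («rank-1 `β` represented by `a′` = ONE orbit up to norms; unrepresented `β` ⇒ the functional is `0`»).

HONEST LABEL: HC_CM is proved only modulo the 7 printed citations (2 remaining named inputs: hLiu418 = stmt-HodgeConjecture-24832, h413 =
stmt-HodgeConjecture-24833) until rung 0 closes; this file is one half of organ U2c of Road I for #42F′ and moves no counter.

## References
* [KudlaRallis1994] S. S. Kudla, S. Rallis, *A regularized Siegel–Weil formula: the first term identity*, Ann. of Math. 140 (1994) 1–80, §3.
* [Rallis1984] S. Rallis, *On the Howe duality conjecture*, Compositio Math. 51 (1984) 333–399, §4.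
* [Omeara1963] O. T. O'Meara, *Introduction to Quadratic Forms* (1963), §65D Thm. 65:23 (Hasse norm theorem).
* [Scharlau1985HermitianForms] W. Scharlau, *Quadratic and Hermitian Forms*, Grundlehren 270 (1985), Ch. 10 §1 (hermitian forms over fields with involution; Landherr).
* [Liu2021] Y. Liu, Camb. J. Math. 9 (2021) = arXiv:2102.11518, Def. 4.11–4.12.
-/

set_option autoImplicit false
set_option linter.dupNamespace false

noncomputable section

open Set NumberField IsDedekindDomain
open scoped Matrix
open Literature.NumberTheory.Automorphic Literature.RepresentationTheory
open Literature.NumberTheory.Automorphic.UnitaryGroup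
open Literature.NumberTheory.QuadraticForms
open Literature.NumberTheory.Automorphic.Liu2021.Def411WeilCarriers
open Literature.NumberTheory.GelbartRogawski1991.UnitaryDualPair
open Summit.HodgeConjecture.HodgeConjecture.Cruxes.HLiu418.K2LiuRankOneLineGram

namespace Summit.HodgeConjecture.HodgeConjecture.Cruxes.HLiu418.K2LiuRankOneOrbitUniformity

/-! ## §1 Local norm classes on `L ⊗ L⁺_v` -/

section LocalNorm

variable {F : Type} [Field F] [NumberField F] (E : Type) [Field E] [NumberField E] [Algebra F E]
  [Algebra.IsQuadraticExtension F E] (c : E ≃ₐ[F] E) {δ : E} (hcδ : c δ = -δ) (hδ : δ ≠ 0) {d : F}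
  (hd : δ * δ = algebraMap F E d) (v : HeightOneSpectrum (𝓞 F))

omit [Algebra.IsQuadraticExtension F E] in
include hcδ hd in
/-- **the local norm form**: `(ι_v x + ι_v y·δ) · (c ⊗ 1)(ι_v x + ι_v y·δ) = ι_v(x² − δ² y²)` in `E ⊗_F F_v`. [cite: Liu2021, Def. 4.11–4.12] -/
theorem add_mul_delta_mul_conjLocal (x y : v.adicCompletion F) :
    (toLocalRing E v x + toLocalRing E v y * algebraMap E (LocalRing E v) δ) *
        conjLocal E c v (toLocalRing E v x + toLocalRing E v y * algebraMap E (LocalRing E v) δ) =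
      toLocalRing E v (x ^ 2 - algebraMap F (v.adicCompletion F) d * y ^ 2) := by
  have hδ2 : algebraMap E (LocalRing E v) δ * algebraMap E (LocalRing E v) δ = toLocalRing E v (algebraMap F (v.adicCompletion F) d) := by
    rw [← map_mul, hd, ← toLocalRing_coe]
    rfl
  rw [map_add, map_mul, conjLocal_toLocalRing, conjLocal_toLocalRing, conjLocal_algebraMap, hcδ, map_neg, map_sub, map_mul, map_pow,
    map_pow, ← hδ2]
  ring

include hcδ hδ hd in
/-- **«`σ(t) t` in `E ⊗ F_v` ⇒ a local norm»**: if `ι_v t = z · (c ⊗ 1) z` then `t ∈ Nm = {x² − δ² y²}` (★ `quadraticNormSubgroup`, the currency of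
★ `locF`). [cite: Liu2021, Def. 4.11–4.12] -/
theorem mem_quadraticNormSubgroup_of_eq_mul_conjLocal (t : (v.adicCompletion F)ˣ) (z : LocalRing E v)
    (h : toLocalRing E v (t : v.adicCompletion F) = z * conjLocal E c v z) :
    t ∈ quadraticNormSubgroup (v.adicCompletion F) (algebraMap F (v.adicCompletion F) d) := by
  obtain ⟨p, hp, -⟩ := existsUnique_eq_add_mul E v c hcδ hδ z
  rw [hp, add_mul_delta_mul_conjLocal E c hcδ hd v] at h
  exact ⟨p.1, p.2, (toLocalRing_injective E v h).symm⟩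

end LocalNorm

/-! ## §2 The CM field: `locF` classes, the global line-Gram transport and the one congruence orbit (Hasse BY NAME) -/

section CM

variable (L : Type) [Field L] [NumberField L] [IsCMField L]

/-- **equal line classes from a local norm presentation**: if `ι_v b = ι_v a · (z · z̄)` in `L ⊗ L⁺_v` (`z̄ = (c ⊗ 1) z`) then `locF b v = locF a v` in
`L⁺_v^× ∕ Nm` (★ `locF_apply`). [cite: Liu2021, Def. 4.11–4.12] -/
theorem locF_eq_of_eq_mul_conjLocal (a b : (↥(maximalRealSubfield L))ˣ) (v : HeightOneSpectrum (𝓞 ↥(maximalRealSubfield L)))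
    (z : LocalRing L v)
    (h : toLocalRing L v (algebraMap ↥(maximalRealSubfield L) (v.adicCompletion ↥(maximalRealSubfield L)) (b : ↥(maximalRealSubfield L))) =
      toLocalRing L v (algebraMap ↥(maximalRealSubfield L) (v.adicCompletion ↥(maximalRealSubfield L)) (a : ↥(maximalRealSubfield L))) *
        (z * conjLocal L (IsCMField.complexConj L) v z)) :
    locF ↥(maximalRealSubfield L) (imagUnitSq L) b v = locF ↥(maximalRealSubfield L) (imagUnitSq L) a v := by
  rw [locF_apply, locF_apply, QuotientGroup.eq]
  set φ : ↥(maximalRealSubfield L) →* v.adicCompletion ↥(maximalRealSubfield L) :=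
    (algebraMap ↥(maximalRealSubfield L) (v.adicCompletion ↥(maximalRealSubfield L))).toMonoidHom with hφ
  have ha0 : algebraMap ↥(maximalRealSubfield L) (v.adicCompletion ↥(maximalRealSubfield L)) (a : ↥(maximalRealSubfield L)) ≠ 0 :=
    (map_ne_zero _).2 a.ne_zero
  have ht : (Units.map φ a)⁻¹ * Units.map φ b ∈
      quadraticNormSubgroup (v.adicCompletion ↥(maximalRealSubfield L)) (algebraMap ↥(maximalRealSubfield L) _ (imagUnitSq L)) := by
    refine mem_quadraticNormSubgroup_of_eq_mul_conjLocal L (IsCMField.complexConj L) (complexConj_imagUnit L) (imagUnit_ne_zero L)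
      (imagUnit_mul_self L) v _ z ?_
    have hval : (((Units.map φ a)⁻¹ * Units.map φ b : (v.adicCompletion ↥(maximalRealSubfield L))ˣ) : v.adicCompletion ↥(maximalRealSubfield L)) =
        (algebraMap ↥(maximalRealSubfield L) _ (a : ↥(maximalRealSubfield L)))⁻¹ * algebraMap ↥(maximalRealSubfield L) _ (b : ↥(maximalRealSubfield L)) := by
      rw [Units.val_mul, Units.val_inv_eq_inv_val]
      rfl
    rw [hval, map_mul, h, ← mul_assoc, ← map_mul, inv_mul_cancel₀ ha0, map_one, one_mul]
  have := Subgroup.inv_mem _ ht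
  rwa [mul_inv_rev, inv_inv] at this

/-- **«U2c-glob» — NORMS TRANSPORT THE LINE GRAM GLOBALLY (Hasse BY NAME)**: if the hermitian lines `⟨b⟩`, `⟨a′⟩` over the CM field `L` have the same
class at every finite place of `L⁺` (`locF b = locF a′`) and `b ∕ a′` is totally positive, then `b = a′ · ē e` for some `e ≠ 0` (★
`F0LD1LineClassHasse.exists_eq_mul_complexConj_of_locF_eq_of_totallyPositive` = Hasse's norm theorem for `L ∕ L⁺`, [Omeara1963, 65:23]), hence EVERY Gram matrix of
`⟨b⟩` is a Gram matrix of `⟨a′⟩`: `b · ū ⊗ u = a′ · \overline{(e u)} ⊗ (e u)`. [cite: Omeara1963, §65D Thm. 65:23] [cite: Scharlau1985HermitianForms, Ch. 10 §1] -/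
theorem lineGram_transport_of_locF_eq_of_totallyPositive (a' b : (↥(maximalRealSubfield L))ˣ) {ι : Type*} (u : ι → L)
    (hloc : ∀ v : HeightOneSpectrum (𝓞 ↥(maximalRealSubfield L)),
      locF ↥(maximalRealSubfield L) (imagUnitSq L) b v = locF ↥(maximalRealSubfield L) (imagUnitSq L) a' v)
    (hpos : ∀ ρ : ↥(maximalRealSubfield L) →+* ℝ, 0 < ρ ((b : ↥(maximalRealSubfield L)) * ((a' : ↥(maximalRealSubfield L)))⁻¹)) :
    ∃ e : L, e ≠ 0 ∧
      algebraMap ↥(maximalRealSubfield L) L b • Matrix.vecMulVec (⇑(IsCMField.complexConj L) ∘ u) u =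
        algebraMap ↥(maximalRealSubfield L) L a' • Matrix.vecMulVec (⇑(IsCMField.complexConj L) ∘ (e • u)) (e • u) := by
  obtain ⟨e, he⟩ := F0LD1LineClassHasse.exists_eq_mul_complexConj_of_locF_eq_of_totallyPositive L b a' hloc hpos
  have hne : (b : ↥(maximalRealSubfield L)) * ((a' : ↥(maximalRealSubfield L)))⁻¹ ≠ 0 := mul_ne_zero b.ne_zero (inv_ne_zero a'.ne_zero)
  refine ⟨e, F0LD1LineClassHasse.ne_zero_of_eq_mul_complexConj L hne he, ?_⟩
  have ha' : algebraMap ↥(maximalRealSubfield L) L (a' : ↥(maximalRealSubfield L)) ≠ 0 := (map_ne_zero _).2 a'.ne_zero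
  have hb : algebraMap ↥(maximalRealSubfield L) L b =
      algebraMap ↥(maximalRealSubfield L) L a' * ((IsCMField.complexConj L : L →+* L) e * e) := by
    calc algebraMap ↥(maximalRealSubfield L) L b
        = algebraMap ↥(maximalRealSubfield L) L a' *
            algebraMap ↥(maximalRealSubfield L) L ((b : ↥(maximalRealSubfield L)) * ((a' : ↥(maximalRealSubfield L)))⁻¹) := by
          rw [map_mul, map_inv₀, mul_left_comm, mul_inv_cancel₀ ha', mul_one]
      _ = _ := by rw [he, mul_comm e]; rfl
  exact smul_vecMulVec_conj_eq_of_eq_mul_conj_mul_self (IsCMField.complexConj L : L →+* L) hb u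

/-- **U2c «RANK-ONE ORBIT UNIFORMITY»** (the head).  A rank-one hermitian `β = (c γ)ᵀ · diag(b, 0) · γ` over the CM field `L` (the class of `diag(b, 0)`,
`γ` any `2 × κ` matrix, e.g. `γ ∈ GL₂(L)`) whose line `⟨b⟩` has the class of `⟨a′⟩` at EVERY finite place (the output of «U2c-fin» place by place) and
with `b ∕ a′` totally positive («U2c-arch», organ Hol) lies in the congruence orbit of `diag(a′, 0)`: `β = (c γ′)ᵀ · diag(a′, 0) · γ′` with
`γ′ = diag(e, 1) · γ`, `e ≠ 0` — ONE `GL₂(L)`-orbit carries all the non-vanishing rank-one coefficients. [cite: Omeara1963, §65D Thm. 65:23]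
[cite: Scharlau1985HermitianForms, Ch. 10 §1] [cite: KudlaRallis1994, §3] -/
theorem rankOneOrbitUniformity (a' b : (↥(maximalRealSubfield L))ˣ) {κ : Type*} (γ : Matrix (Fin 2) κ L)
    (hloc : ∀ v : HeightOneSpectrum (𝓞 ↥(maximalRealSubfield L)),
      locF ↥(maximalRealSubfield L) (imagUnitSq L) b v = locF ↥(maximalRealSubfield L) (imagUnitSq L) a' v)
    (hpos : ∀ ρ : ↥(maximalRealSubfield L) →+* ℝ, 0 < ρ ((b : ↥(maximalRealSubfield L)) * ((a' : ↥(maximalRealSubfield L)))⁻¹)) :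
    ∃ e : L, e ≠ 0 ∧
      (γ.map (IsCMField.complexConj L))ᵀ * Matrix.diagonal ![algebraMap ↥(maximalRealSubfield L) L b, 0] * γ =
        ((Matrix.diagonal ![e, 1] * γ).map (IsCMField.complexConj L))ᵀ * Matrix.diagonal ![algebraMap ↥(maximalRealSubfield L) L a', 0] *
          (Matrix.diagonal ![e, 1] * γ) := by
  obtain ⟨e, he0, he⟩ := lineGram_transport_of_locF_eq_of_totallyPositive L a' b (γ 0) hloc hpos
  refine ⟨e, he0, ?_⟩
  have hrow : (Matrix.diagonal ![e, 1] * γ) 0 = e • γ 0 := by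
    funext k
    rw [Matrix.diagonal_mul]
    rfl
  have h1 := map_transpose_mul_diagonal_mul (IsCMField.complexConj L : L →+* L) (algebraMap ↥(maximalRealSubfield L) L b) γ
  have h2 := map_transpose_mul_diagonal_mul (IsCMField.complexConj L : L →+* L) (algebraMap ↥(maximalRealSubfield L) L a')
    (Matrix.diagonal ![e, 1] * γ)
  rw [hrow] at h2
  exact h1.trans (he.trans h2.symm)

/-- **«U2c-fin» AT THE DOCK (place `v` of `L⁺`, `R = L ⊗ L⁺_v = LocalRing L v`, `σ = c ⊗ 1 = conjLocal`)**: in the σ-explicit Schrödinger-type model of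
U2a at `v` for the line `⟨a′⟩` (multipliers `ψ(⟪b z, ι_v a′ · σ(v x) ⊗ v x⟫)`), if the coefficient character is `ψ_β` with `β = ι_v b · σ(u) ⊗ u` for a
UNIMODULAR `u` (`u · c = 1`; the class of `diag(b, 0)`) and some `ψ_β`-quasi-invariant functional is NON-ZERO, then the lines `⟨b⟩` and `⟨a′⟩` have
the same class at `v`: `locF b v = locF a′ v` (`b ∕ a′ ∈ Nm L_v^×`). [cite: KudlaRallis1994, §3] [cite: Rallis1984, §4] [cite: Liu2021, Def. 4.11–4.12] -/
theorem locF_eq_of_functional_ne_zero (v : HeightOneSpectrum (𝓞 ↥(maximalRealSubfield L)))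
    (π : Matrix (Fin 2) (Fin 2) (LocalRing L v) →ₗ[v.adicCompletion ↥(maximalRealSubfield L)]
      Matrix (Fin 2) (Fin 2) (LocalRing L v) →ₗ[v.adicCompletion ↥(maximalRealSubfield L)] v.adicCompletion ↥(maximalRealSubfield L))
    (hπ : ∀ H : Matrix (Fin 2) (Fin 2) (LocalRing L v), (H.map (conjLocal L (IsCMField.complexConj L) v))ᵀ = H → H ≠ 0 →
      ∃ s : Matrix (Fin 2) (Fin 2) (LocalRing L v), (s.map (conjLocal L (IsCMField.complexConj L) v))ᵀ = s ∧ π s H ≠ 0)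
    (ψ : AddChar (v.adicCompletion ↥(maximalRealSubfield L)) Circle) (hψ : ∃ t, ((ψ t : Circle) : ℂ) ≠ 1)
    {X : Type*} [TopologicalSpace X] {Z : Type*} [Group Z] (ρ : Representation ℂ Z ↥(SchwartzBruhat X))
    (bZ : Z → Matrix (Fin 2) (Fin 2) (LocalRing L v))
    (hb : ∀ s : Matrix (Fin 2) (Fin 2) (LocalRing L v), (s.map (conjLocal L (IsCMField.complexConj L) v))ᵀ = s → ∃ z, bZ z = s)
    (a' b : (↥(maximalRealSubfield L))ˣ) (vx : X → Fin 2 → LocalRing L v) (u c : Fin 2 → LocalRing L v) (hc : u ⬝ᵥ c = 1)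
    (hu : ∀ z, IsLocallyConstant fun x => ((ψ (π (bZ z)
      (toLocalRing L v (algebraMap ↥(maximalRealSubfield L) _ (a' : ↥(maximalRealSubfield L))) •
        Matrix.vecMulVec (⇑(conjLocal L (IsCMField.complexConj L) v) ∘ vx x) (vx x))) : Circle) : ℂ))
    (hρ : ∀ (z : Z) (φ : ↥(SchwartzBruhat X)), ((ρ z φ : ↥(SchwartzBruhat X)) : X → ℂ) =
      (fun x => ((ψ (π (bZ z)
        (toLocalRing L v (algebraMap ↥(maximalRealSubfield L) _ (a' : ↥(maximalRealSubfield L))) •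
          Matrix.vecMulVec (⇑(conjLocal L (IsCMField.complexConj L) v) ∘ vx x) (vx x))) : Circle) : ℂ)) * φ)
    (χ : Z →* ℂˣ)
    (hχ : ∀ z, ((χ z : ℂˣ) : ℂ) = ((ψ (π (bZ z)
      (toLocalRing L v (algebraMap ↥(maximalRealSubfield L) _ (b : ↥(maximalRealSubfield L))) •
        Matrix.vecMulVec (⇑(conjLocal L (IsCMField.complexConj L) v) ∘ u) u)) : Circle) : ℂ))
    {M : Type*} [AddCommGroup M] [Module ℂ M] :
    ∀ Λ : ↥(SchwartzBruhat X) →ₗ[ℂ] M, (∀ (z : Z) (φ : ↥(SchwartzBruhat X)), Λ (ρ z φ) = ((χ z : ℂˣ) : ℂ) • Λ φ) → Λ ≠ 0 →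
      locF ↥(maximalRealSubfield L) (imagUnitSq L) b v = locF ↥(maximalRealSubfield L) (imagUnitSq L) a' v := by
  intro Λ hΛ hΛ0
  have hσ := conjLocal_conjLocal_cm L v
  have hσF : ∀ t : v.adicCompletion ↥(maximalRealSubfield L), conjLocal L (IsCMField.complexConj L) v
      (algebraMap (v.adicCompletion ↥(maximalRealSubfield L)) (LocalRing L v) t) = algebraMap _ _ t :=
    fun t => conjLocal_toLocalRing (IsCMField.complexConj L) v t
  have ha : conjLocal L (IsCMField.complexConj L) v (toLocalRing L v (algebraMap ↥(maximalRealSubfield L) _ (a' : ↥(maximalRealSubfield L)))) =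
      toLocalRing L v (algebraMap ↥(maximalRealSubfield L) _ (a' : ↥(maximalRealSubfield L))) := conjLocal_toLocalRing _ v _
  have hβh := map_transpose_smul_vecMulVec_conj (conjLocal L (IsCMField.complexConj L) v) hσ
    (conjLocal_toLocalRing (IsCMField.complexConj L) v (algebraMap ↥(maximalRealSubfield L) _ (b : ↥(maximalRealSubfield L)))) u
  obtain ⟨x, hx⟩ := exists_lineGram_eq_of_functional_ne_zero (conjLocal L (IsCMField.complexConj L) v) hσ hσF π hπ ψ hψ ρ bZ hb _ ha vx _
    hu hρ χ hχ hβh Λ hΛ hΛ0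
  have hB := eq_mul_conj_mul_self_of_smul_vecMulVec_eq (conjLocal L (IsCMField.complexConj L) v) hx c hc
  exact locF_eq_of_eq_mul_conjLocal L a' b v (vx x ⬝ᵥ c) (by rw [hB, mul_comm (conjLocal L _ v _) (vx x ⬝ᵥ c)])

end CM

end Summit.HodgeConjecture.HodgeConjecture.Cruxes.HLiu418.K2LiuRankOneOrbitUniformity

end
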